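/-
Copyright (c) 2026 the pub-hodgecm-mathlib formalisation cell (harness21).  Prover seat hodgecm-mathlib-K2E1-p16 (g2), Track B ∕ K2-LIT, h413 = `stmt-HodgeConjecture-24833`,
route of record `HCCMUnconditional`; R90-TF section S8 «ContSpec-n½» (dealer R90-CS-plan (g0), LEAD K2E1-plan (g7)), «U(Φ₃) χ-TWIN row 4b» (TWIN-DAG v1 §B.4): the N = 3 twin of ★
`K2E1ChiEisensteinSolvesXSystemU2` (K2-defs1 (g6)) — INDEX-FREE per RULING S8-R10 (a) (left-`N(𝔸)B(F)`-invariance + bounds as hypotheses; the pair currency reads them by ★ D-S8-3).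
-/
import Summits.HodgeConjecture.HodgeConjecture.Theorems.K2E1ChiEisensteinSolvesXSystemU2        -- ★ (K2-defs1 g6): RANK-GENERIC §1 `cnstN_toHN_eq_toHN_borelConstantTerm_of_measurable` (Borel P2b′), `flatSectionU_mul_of_mem_comap`; brings ★ `iota_toHX_eq_toHN`, `memLp_zFun_of_iotaBound`, `starProjection_topologicalClosure_span_eq_zero`
import Summits.HodgeConjecture.HodgeConjecture.Theorems.K2E1SphericalEisensteinSolvesXSystemU3    -- ★ N = 3 spherical part 1: `lintegral_tsum_enorm_flatSectionU_mul_enorm_lt_top_cm_three`; brings ★ `…InWeightedSpaceU3.integral_quotFun_eisensteinSeriesU_mul_conj_eq_zero_of_mem_cuspTestClass_cm_three`, ★ `exists_pos_forall_le_supHeight_cm_three`, ★ `continuous_eisensteinSeriesU_flatSectionU_cm_three`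
import Summits.HodgeConjecture.HodgeConjecture.Theorems.K2E1ChiIntertwinedSectionU3               -- ★ p861904 (this seat) row 4a: `isChiSectionPair_intertwinedCoeff_three`; brings ★ `flatSectionU_intertwinedCoeff` (`H^{z−2}·H^{2−z} = 1`), ★ D-S8-3
import HarnessLib

/-!
# S8 «U(Φ₃) χ-TWIN» row 4b — `K2E1ChiEisensteinSolvesXSystemU3`: «`E(f_z)` SOLVES THE (χ,τ) 𝔛-SYSTEM» on `U(2,1)_{L∕L⁺}` — (S2) the constant-term equation with a VECTOR unknown (the
# `(χ₁ʷ, χ₂)`-pair-section `φ̃ = (M(w₀)f_z)·H^{z−2}`), (S3) `Q [Ẽ(f_z)] = 0`, for a bounded continuous left-`N(𝔸)B(F)`-invariant section `φ` and `2 < Re z` — the N = 3 twin of ★ `K2E1ChiEisensteinSolvesXSystemU2`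

Cell `pub/hodgecm-mathlib`, crux H413 = `stmt-HodgeConjecture-24833`; R90-TF section S8 (Rogawski 1990 §13.9; the U(Φ₃) χ-twins feed R1₃ of S8B#2's road and E-S8-def-cont).  THEOREMS ONLY (no
`def`, no `instance`, no notation, no named-fact hypothesis, no `sorry`); lane `--supports stmt-HodgeConjecture-24833 --as helper` (count-neutral).  Closes no socket.

INDEXING (RULING S8-R10).  Every statement here takes the section `φ` through INVARIANCE HYPOTHESES ONLY — left-`B(F)`-invariance `hφB : ∀ b ∈ B(F), φ(ι b · x) = φ x`, left-`N(𝔸)`-invariance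
`hφN`, the right `(K′, ω)`-law `hφK`, continuity∕measurability and a bound — so the file serves BOTH currencies: for a `(χ₁, χ₂)`-pair-section (★ D-S8-3 `IsChiSectionPair`) read
`hφB := IsChiSectionPair.toAdelic_mul hφ hχ₂` (the ONE place the automorphy `hχ₂ : TorusDict.IsAutomorphic c χ₂` enters), `hφN := IsChiSectionPair.unipotent_mul hφ`; the fact that the vector
unknown `φ̃` is again a pair-section is ★ row 4a `isChiSectionPair_intertwinedCoeff_three`, and its membership in the finite-dimensional `V((χ₁ʷ, χ₂), K′, ω)` is §1 + row 4a once
`chiSectionSpacePair` (D-S8-3 ED.2, K2-defs1) is ★ (a 3-line corollary, NOT typed here).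
THE MATHEMATICS ([BernsteinLapid2019, §4 Claims 1–5, §7]; [MoeglinWaldspurger1995, I.2.6, II.1.7, IV.1.8]) — verbatim the N = 2 original with the N = 3 exponents: Godement range `2 < Re z`,
reflection `z ↦ 2 − z`, intertwined coefficient `φ̃ = (M(w₀)f_z)·H^{z−2}` (★ `flatSectionU_intertwinedCoeff`), the N = 3 spherical majorant (no `δ`-binders), ★ N = 3 «E ⊥ 𝒞_k».
* §1 (generic-rank ★ by import: Borel P2b′ `cnstN_toHN_eq_toHN_borelConstantTerm_of_measurable`, `flatSectionU_mul_of_mem_comap`) + **`intertwinedCoeff_mul_right_of_rightLaw`** (`φ̃(g k) = ω(k)φ̃(g)`, index-free).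
* §2 `eisensteinSeriesU_flatSectionU_quotientSubgroup_mul_of_borelU_invariant`, **`cnstN_iota_toHX_eisensteinSeriesU_eq_chi_cm_three`** ((S2)χ₃, hypothesis-first on the CT letter `hct`).
* §3 `tsum_enorm_flatSectionU_le_mul_tsum`, `lintegral_tsum_enorm_flatSectionU_mul_enorm_lt_top_chi_cm_three`, `inner_toHX_eisensteinSeriesU_eq_zero_chi_cm_three`, **`starProjection_toHX_eisensteinSeriesU_eq_zero_chi_cm_three`** ((S3)χ₃).
HONEST LABEL: HC_CM is proved only modulo the 7 printed citations (2 remaining named inputs: hLiu418 = `stmt-HodgeConjecture-24832`, h413 = `stmt-HodgeConjecture-24833`) until rung 0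
closes; count-neutral helper, closes no socket.  Letters: `hct` (row 2 at N = 3 — law-bearing, D-S8-3 pair currency, NOT here), `hb`∕`hdis′`∕`hα₁`∕`hα₂` structural as at N = 2.

## References
* [BernsteinLapid2019] J. Bernstein, E. Lapid, *On the meromorphic continuation of Eisenstein series*, arXiv:1911.02342, §4 (Claims 1–5, pp. 9–10), §7.
* [MoeglinWaldspurger1995] C. Mœglin, J.-L. Waldspurger, *Spectral decomposition and Eisenstein series* (1995), I.2.6, II.1.7, IV.1.8.
-/

set_option autoImplicit false
-- the mandated namespace repeats the single-problem summit's segment (`HodgeConjecture.HodgeConjecture`)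
set_option linter.dupNamespace false

noncomputable section

open MeasureTheory Measure NumberField IsDedekindDomain Set Filter MulAction
open scoped ENNReal NNReal ComplexConjugate
open Literature.MeasureTheory.Group Literature.NumberTheory Literature.NumberTheory.Automorphic Literature.NumberTheory.Automorphic.UnitaryGroup AdelicGroupData
open Literature.NumberTheory.GaloisRepresentations (HeckeCharacter)
open Summit.HodgeConjecture.HodgeConjecture.Cruxes.H413.K2E1BorelEisensteinU
open Summit.HodgeConjecture.HodgeConjecture.Cruxes.H413.K2E1BLBorelSpacesU2Defs
open Summit.HodgeConjecture.HodgeConjecture.Cruxes.H413.K2E1BLBorelOperatorsU2Defs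
open Summit.HodgeConjecture.HodgeConjecture.Cruxes.H413.K2E1CharacterEisensteinU2Defs
open Summit.HodgeConjecture.HodgeConjecture.Cruxes.H413.K2E1ChiSectionSpaceU2Defs
open Summit.HodgeConjecture.HodgeConjecture.Cruxes.H413.K2E1MaassSelbergCMThreeIntertwined (flatSectionU_intertwinedCoeff)
open Summit.HodgeConjecture.HodgeConjecture.Cruxes.H413.K2E1MaassSelbergBracketsThree (measurable_flatSectionU)
open Summit.HodgeConjecture.HodgeConjecture.Cruxes.H413.K2E1TruncatedCuspConstantTermAEU2 (sFinite_of_isHaarMeasure_adelicUnipotent)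
open Summit.HodgeConjecture.HodgeConjecture.Cruxes.H413.K2E1SphericalEisensteinSolvesXSystemU2 (iota_toHX_eq_toHN memLp_zFun_of_iotaBound starProjection_topologicalClosure_span_eq_zero)
open Summit.HodgeConjecture.HodgeConjecture.Cruxes.H413.K2E1SphericalEisensteinSolvesXSystemU3 (lintegral_tsum_enorm_flatSectionU_mul_enorm_lt_top_cm_three)
open Summit.HodgeConjecture.HodgeConjecture.Cruxes.H413.K2E1ChiEisensteinSolvesXSystemU2 (cnstN_toHN_eq_toHN_borelConstantTerm_of_measurable)
open Summit.HodgeConjecture.HodgeConjecture.Cruxes.H413.K2E1BLEisensteinMemHXCMThree (exists_pos_forall_le_supHeight_cm_three)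
open Summit.HodgeConjecture.HodgeConjecture.Cruxes.H413.K2E1BLEisensteinInWeightedSpaceU3 (integral_quotFun_eisensteinSeriesU_mul_conj_eq_zero_of_mem_cuspTestClass_cm_three)
open Summit.HodgeConjecture.HodgeConjecture.Cruxes.H413.K2E1BLHeckeOperatorHXU2 (measurable_supHeight)
open Summit.HodgeConjecture.HodgeConjecture.Cruxes.H413.K2E1BorelCosetsDictionary (forall_arithmeticBorel_iff)
open Summit.HodgeConjecture.HodgeConjecture.Cruxes.H413.K2E1BorelEisensteinRegularCMThree (continuous_eisensteinSeriesU_flatSectionU_cm_three)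

namespace Summit.HodgeConjecture.HodgeConjecture.Cruxes.H413.K2E1ChiEisensteinSolvesXSystemU3

/-! ## §1 The intertwined coefficient keeps the right `(K′, ω)`-law (index-free) -/

section IntertwinedThree

variable {F E : Type} [Field F] [NumberField F] [Field E] [NumberField E] [Algebra F E] {c : E ≃ₐ[F] E}
variable [MeasurableSpace (quasiSplit F E c 3).Adelic] [BorelSpace (quasiSplit F E c 3).Adelic]
variable {χ : HeckeCharacter E} {K' : Subgroup (quasiSplit F E c 3).Adelic} {ω : ↥K' → ℂ}

omit [BorelSpace (quasiSplit F E c 3).Adelic] in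
/-- **`φ̃(g k) = ω(k)·φ̃(g)`** for the intertwined coefficient `φ̃ = (M(w₀) f_z)·H^{z−2}` of a section `φ` with the right `(K′, ω)`-law `φ(g k) = ω(k)φ(g)`, `K′ ≤ K` (`W v (g k) = (W v g) k`,
`H(g k) = H(g)`) — INDEX-FREE (RULING S8-R10 (a)): only the right law of `φ` is used; for `φ ∈ chiSectionSpacePair χ₁ χ₂ K′ ω` (D-S8-3 ED.2) read `hφK := apply_mul_of_mem`.
[cite: MoeglinWaldspurger1995, II.1.6] -/
theorem intertwinedCoeff_mul_right_of_rightLaw (ν : Measure ↥(adelicUnipotent F E c 3))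
    (hK' : K' ≤ ((standardMaximalCompactGL 3 E).comap (adelicVal F E c 3 ((StdForm.antidiagonal 3).over E)) : Subgroup (quasiSplit F E c 3).Adelic))
    {φ : (quasiSplit F E c 3).Adelic → ℂ} (hφK : ∀ (g : (quasiSplit F E c 3).Adelic) (k₀ : ↥K'), φ (g * (k₀ : (quasiSplit F E c 3).Adelic)) = ω k₀ * φ g) (z : ℂ) (g : (quasiSplit F E c 3).Adelic) (k₀ : ↥K') :
    (∫ v : ↥(adelicUnipotent F E c 3), flatSectionU φ z ((quasiSplit F E c 3).toAdelic (weylLongU (c : E →+* E) (rfl : (StdForm.antidiagonal 3).over E = (StdForm.antidiagonal 3).over E)) *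
        ((v : (quasiSplit F E c 3).Adelic) * (g * (k₀ : (quasiSplit F E c 3).Adelic)))) ∂ν) * (((borelHeight (g * (k₀ : (quasiSplit F E c 3).Adelic)) : ℝ) : ℂ) ^ (z - 2)) =
      ω k₀ * ((∫ v : ↥(adelicUnipotent F E c 3), flatSectionU φ z ((quasiSplit F E c 3).toAdelic (weylLongU (c : E →+* E) (rfl : (StdForm.antidiagonal 3).over E = (StdForm.antidiagonal 3).over E)) *
        ((v : (quasiSplit F E c 3).Adelic) * g)) ∂ν) * (((borelHeight g : ℝ) : ℂ) ^ (z - 2))) := by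
  have hfk : ∀ y : (quasiSplit F E c 3).Adelic, flatSectionU φ z (y * (k₀ : (quasiSplit F E c 3).Adelic)) = ω k₀ * flatSectionU φ z y := fun y => by
    rw [flatSectionU_apply, flatSectionU_apply, hφK y k₀, borelHeight_mul_of_mem_comap_standardMaximalCompactGL (hK' k₀.2) y, mul_assoc]
  have h1 : ∀ v : ↥(adelicUnipotent F E c 3), flatSectionU φ z ((quasiSplit F E c 3).toAdelic (weylLongU (c : E →+* E) (rfl : (StdForm.antidiagonal 3).over E = (StdForm.antidiagonal 3).over E)) *
        ((v : (quasiSplit F E c 3).Adelic) * (g * (k₀ : (quasiSplit F E c 3).Adelic)))) =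
      ω k₀ * flatSectionU φ z ((quasiSplit F E c 3).toAdelic (weylLongU (c : E →+* E) (rfl : (StdForm.antidiagonal 3).over E = (StdForm.antidiagonal 3).over E)) * ((v : (quasiSplit F E c 3).Adelic) * g)) :=
    fun v => by rw [← mul_assoc, ← mul_assoc, hfk, mul_assoc]
  simp_rw [h1]
  rw [integral_const_mul, borelHeight_mul_of_mem_comap_standardMaximalCompactGL (hK' k₀.2) g]
  ring

end IntertwinedThree

/-! ## §2 (S2)χ The constant-term equation `cnst_N (ι [Ẽ(f_z)]) = [f_z] + (ν𝓕)⁻¹ • [φ̃·H^{2−z}]` on `U(2,1)_{L∕L⁺}` -/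

section ConstantTerm

variable (L : Type) [Field L] [NumberField L] [IsCMField L]
variable [MeasurableSpace (quasiSplit (↥(maximalRealSubfield L)) L (IsCMField.complexConj L) 3).Adelic] [BorelSpace (quasiSplit (↥(maximalRealSubfield L)) L (IsCMField.complexConj L) 3).Adelic]

omit [MeasurableSpace (quasiSplit (↥(maximalRealSubfield L)) L (IsCMField.complexConj L) 3).Adelic] [BorelSpace (quasiSplit (↥(maximalRealSubfield L)) L (IsCMField.complexConj L) 3).Adelic] in
/-- `E(f_z)` of a left-`B(F)`-invariant `φ` is left-`G(F)`-invariant in the `quotientSubgroup` spelling (★ `eisensteinSeriesU_flatSectionU_rational_mul`, ★ `quotientSubgroup_quasiSplit`) —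
INDEX-FREE; for a `(χ₁, χ₂)`-pair-section read `hφB := IsChiSectionPair.toAdelic_mul hφ hχ₂` (★ D-S8-3; the ONE place χ₂'s automorphy enters). [cite: MoeglinWaldspurger1995, II.1.5] -/
theorem eisensteinSeriesU_flatSectionU_quotientSubgroup_mul_of_borelU_invariant {φ : (quasiSplit (↥(maximalRealSubfield L)) L (IsCMField.complexConj L) 3).Adelic → ℂ}
    (hφB : ∀ b ∈ borelU ((IsCMField.complexConj L : L ≃ₐ[↥(maximalRealSubfield L)] L) : L →+* L) ((StdForm.antidiagonal 3).over L),
      ∀ x : (quasiSplit (↥(maximalRealSubfield L)) L (IsCMField.complexConj L) 3).Adelic, φ ((quasiSplit (↥(maximalRealSubfield L)) L (IsCMField.complexConj L) 3).toAdelic b * x) = φ x) (z : ℂ) :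
    ∀ γ ∈ (quasiSplit (↥(maximalRealSubfield L)) L (IsCMField.complexConj L) 3).quotientSubgroup, ∀ g : (quasiSplit (↥(maximalRealSubfield L)) L (IsCMField.complexConj L) 3).Adelic,
      (eisensteinSeriesU (flatSectionU φ z)) (γ * g) = (eisensteinSeriesU (flatSectionU φ z)) g := by
  intro γ hγ g
  rw [quotientSubgroup_quasiSplit] at hγ
  obtain ⟨γ', hγ'⟩ := MonoidHom.mem_range.1 hγ
  rw [← hγ']
  exact eisensteinSeriesU_flatSectionU_rational_mul hφB z γ' g

/-- **(S2)χ THE CONSTANT-TERM EQUATION FOR `E(f_z)` IN `𝓗_k(Z_a)` WITH A VECTOR UNKNOWN.**  On `U(2,1)_{L∕L⁺}`, `φ` bounded, continuous and left-`B(F)`-invariant (INDEX-FREE: for a pair-section `hφB := IsChiSectionPair.toAdelic_mul hφ hχ₂`), `2 < Re z`, given ROW 2's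
constant term as the letter `hct` (`E_B(f_z) = f_z + (ν𝓕)⁻¹·∫_N f_z(W v ·) dν`, ★ generic unfolding shape) and the structural letters `hb` (★ `IotaBound`), `hdis′` (disintegration):
`cnst_N (ι [Ẽ(f_z)]) = toHN f_z + ((ν𝓕)⁻¹ : ℂ) • toHN (flatSectionU φ̃ (1 − z))`, `φ̃ := (M(w₀) f_z)·H^{z−2}` the intertwined coefficient (a `(χ₁ʷ, χ₂)`-pair-section by ★ row 4a; in `V((χ₁ʷ, χ₂), K′, ω)` once `chiSectionSpacePair` (D-S8-3 ED.2) is ★, §1).  Letters `hα₁`, `hα₂` =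
square-integrability of the `Z`-lifts of `f_z` and `φ̃·H^{2−z}`. [cite: BernsteinLapid2019, §4 (p. 10), §7] [cite: MoeglinWaldspurger1995, I.2.6, II.1.7] -/
theorem cnstN_iota_toHX_eisensteinSeriesU_eq_chi_cm_three
    (ν : Measure ↥(adelicUnipotent (↥(maximalRealSubfield L)) L (IsCMField.complexConj L) 3)) [ν.IsHaarMeasure] [ν.IsMulRightInvariant]
    {𝓕 : Set ↥(adelicUnipotent (↥(maximalRealSubfield L)) L (IsCMField.complexConj L) 3)}
    (h𝓕N : IsFundamentalDomain ↥(rationalUnipotent (↥(maximalRealSubfield L)) L (IsCMField.complexConj L) 3) 𝓕 ν)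
    {μ : Measure (quasiSplit (↥(maximalRealSubfield L)) L (IsCMField.complexConj L) 3).automorphicQuotient} {k : ℕ} {a : ℝ≥0} {μZ : Measure (borelQuotient (↥(maximalRealSubfield L)) L (IsCMField.complexConj L) 3)}
    [IsFiniteMeasure (weightedTruncMeasure (↥(maximalRealSubfield L)) L (IsCMField.complexConj L) 3 k a μZ)]
    (hb : IotaBound (↥(maximalRealSubfield L)) L (IsCMField.complexConj L) 3 k a μ μZ)
    (hdis' : ∀ Φ : (quasiSplit (↥(maximalRealSubfield L)) L (IsCMField.complexConj L) 3).Adelic → ℂ, Measurable Φ → (∀ b ∈ ratBorelSubgroup (↥(maximalRealSubfield L)) L (IsCMField.complexConj L) 3, ∀ g, Φ (b * g) = Φ g) →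
      Integrable (zFun (↥(maximalRealSubfield L)) L (IsCMField.complexConj L) 3 Φ) (weightedTruncMeasure (↥(maximalRealSubfield L)) L (IsCMField.complexConj L) 3 k a μZ) →
      Integrable (zFun (↥(maximalRealSubfield L)) L (IsCMField.complexConj L) 3 (borelConstantTerm ν 𝓕 Φ)) (weightedTruncMeasure (↥(maximalRealSubfield L)) L (IsCMField.complexConj L) 3 k a μZ) →
        ∫ x, zFun (↥(maximalRealSubfield L)) L (IsCMField.complexConj L) 3 (borelConstantTerm ν 𝓕 Φ) x ∂(weightedTruncMeasure (↥(maximalRealSubfield L)) L (IsCMField.complexConj L) 3 k a μZ) =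
          ∫ x, zFun (↥(maximalRealSubfield L)) L (IsCMField.complexConj L) 3 Φ x ∂(weightedTruncMeasure (↥(maximalRealSubfield L)) L (IsCMField.complexConj L) 3 k a μZ))
    {φ : (quasiSplit (↥(maximalRealSubfield L)) L (IsCMField.complexConj L) 3).Adelic → ℂ}
    (hφB : ∀ b ∈ borelU ((IsCMField.complexConj L : L ≃ₐ[↥(maximalRealSubfield L)] L) : L →+* L) ((StdForm.antidiagonal 3).over L),
      ∀ x : (quasiSplit (↥(maximalRealSubfield L)) L (IsCMField.complexConj L) 3).Adelic, φ ((quasiSplit (↥(maximalRealSubfield L)) L (IsCMField.complexConj L) 3).toAdelic b * x) = φ x)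
    (hφc : Continuous φ) {M : ℝ} (hφM : ∀ x, ‖φ x‖ ≤ M)
    {z : ℂ} (hz : 2 < z.re)
    (hct : ∀ g : (quasiSplit (↥(maximalRealSubfield L)) L (IsCMField.complexConj L) 3).Adelic,
      borelConstantTerm ν 𝓕 (eisensteinSeriesU (flatSectionU φ z)) g = flatSectionU φ z g + (((ν 𝓕).toReal⁻¹ : ℝ) : ℂ) *
        ∫ v : ↥(adelicUnipotent (↥(maximalRealSubfield L)) L (IsCMField.complexConj L) 3), flatSectionU φ z ((quasiSplit (↥(maximalRealSubfield L)) L (IsCMField.complexConj L) 3).toAdelic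
          (weylLongU ((IsCMField.complexConj L : L ≃ₐ[↥(maximalRealSubfield L)] L) : L →+* L) (rfl : (StdForm.antidiagonal 3).over L = (StdForm.antidiagonal 3).over L)) *
          ((v : (quasiSplit (↥(maximalRealSubfield L)) L (IsCMField.complexConj L) 3).Adelic) * g)) ∂ν)
    (hE : MemLp ((quasiSplit (↥(maximalRealSubfield L)) L (IsCMField.complexConj L) 3).quotFun (eisensteinSeriesU (flatSectionU φ z))) 2 (μ.withDensity fun x => (((supHeight (↥(maximalRealSubfield L)) L (IsCMField.complexConj L) 3 x)⁻¹ ^ (2 * k) : ℝ≥0) : ℝ≥0∞)))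
    (hα₁ : MemLp (zFun (↥(maximalRealSubfield L)) L (IsCMField.complexConj L) 3 (flatSectionU φ z)) 2 (weightedTruncMeasure (↥(maximalRealSubfield L)) L (IsCMField.complexConj L) 3 k a μZ))
    (hα₂ : MemLp (zFun (↥(maximalRealSubfield L)) L (IsCMField.complexConj L) 3 (flatSectionU (fun g : (quasiSplit (↥(maximalRealSubfield L)) L (IsCMField.complexConj L) 3).Adelic =>
      (∫ v : ↥(adelicUnipotent (↥(maximalRealSubfield L)) L (IsCMField.complexConj L) 3), flatSectionU φ z ((quasiSplit (↥(maximalRealSubfield L)) L (IsCMField.complexConj L) 3).toAdelic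
          (weylLongU ((IsCMField.complexConj L : L ≃ₐ[↥(maximalRealSubfield L)] L) : L →+* L) (rfl : (StdForm.antidiagonal 3).over L = (StdForm.antidiagonal 3).over L)) *
          ((v : (quasiSplit (↥(maximalRealSubfield L)) L (IsCMField.complexConj L) 3).Adelic) * g)) ∂ν) * (((borelHeight g : ℝ) : ℂ) ^ (z - 2))) (2 - z)))
      2 (weightedTruncMeasure (↥(maximalRealSubfield L)) L (IsCMField.complexConj L) 3 k a μZ)) :
    cnstN (↥(maximalRealSubfield L)) L (IsCMField.complexConj L) 3 k a μZ (iota hb (toHX (↥(maximalRealSubfield L)) L (IsCMField.complexConj L) 3 k μ (eisensteinSeriesU (flatSectionU φ z)) hE)) =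
      toHN (↥(maximalRealSubfield L)) L (IsCMField.complexConj L) 3 k a μZ (flatSectionU φ z) hα₁ +
        (((ν 𝓕).toReal⁻¹ : ℝ) : ℂ) • toHN (↥(maximalRealSubfield L)) L (IsCMField.complexConj L) 3 k a μZ _ hα₂ := by
  -- the constant term as a function: `f_z + c • flatSectionU φ̃ (2 - z)`
  have hct' : borelConstantTerm ν 𝓕 (eisensteinSeriesU (flatSectionU φ z)) = flatSectionU φ z + (((ν 𝓕).toReal⁻¹ : ℝ) : ℂ) •
      flatSectionU (fun g : (quasiSplit (↥(maximalRealSubfield L)) L (IsCMField.complexConj L) 3).Adelic =>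
        (∫ v : ↥(adelicUnipotent (↥(maximalRealSubfield L)) L (IsCMField.complexConj L) 3), flatSectionU φ z ((quasiSplit (↥(maximalRealSubfield L)) L (IsCMField.complexConj L) 3).toAdelic
            (weylLongU ((IsCMField.complexConj L : L ≃ₐ[↥(maximalRealSubfield L)] L) : L →+* L) (rfl : (StdForm.antidiagonal 3).over L = (StdForm.antidiagonal 3).over L)) *
            ((v : (quasiSplit (↥(maximalRealSubfield L)) L (IsCMField.complexConj L) 3).Adelic) * g)) ∂ν) * (((borelHeight g : ℝ) : ℂ) ^ (z - 2))) (2 - z) := by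
    funext g
    rw [hct g, Pi.add_apply, Pi.smul_apply, smul_eq_mul, flatSectionU_intertwinedCoeff ν φ z g]
  -- invariances and measurability of `E(f_z)`
  have hφG := eisensteinSeriesU_flatSectionU_quotientSubgroup_mul_of_borelU_invariant L hφB z
  have hφB' : ∀ γ ∈ ratBorelSubgroup (↥(maximalRealSubfield L)) L (IsCMField.complexConj L) 3, ∀ g : (quasiSplit (↥(maximalRealSubfield L)) L (IsCMField.complexConj L) 3).Adelic,
      (eisensteinSeriesU (flatSectionU φ z)) (γ * g) = (eisensteinSeriesU (flatSectionU φ z)) g := fun γ hγ g =>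
    hφG γ ((quasiSplit (↥(maximalRealSubfield L)) L (IsCMField.complexConj L) 3).arithmeticSubgroup_le_quotientSubgroup (ratBorelSubgroup_le_arithmeticSubgroup (↥(maximalRealSubfield L)) L (IsCMField.complexConj L) 3 hγ)) g
  have hφm : Measurable (eisensteinSeriesU (flatSectionU φ z)) := (continuous_eisensteinSeriesU_flatSectionU_cm_three L hz hφc hφM).measurable
  -- the `Z`-lifts of `E(f_z)` and of its constant term are in `L²(wtm)`
  have hφZ : MemLp (zFun (↥(maximalRealSubfield L)) L (IsCMField.complexConj L) 3 (eisensteinSeriesU (flatSectionU φ z))) 2 (weightedTruncMeasure (↥(maximalRealSubfield L)) L (IsCMField.complexConj L) 3 k a μZ) :=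
    memLp_zFun_of_iotaBound hb hφG hE
  have hψ2 : MemLp (zFun (↥(maximalRealSubfield L)) L (IsCMField.complexConj L) 3 (borelConstantTerm ν 𝓕 (eisensteinSeriesU (flatSectionU φ z)))) 2 (weightedTruncMeasure (↥(maximalRealSubfield L)) L (IsCMField.complexConj L) 3 k a μZ) := by
    rw [hct', zFun_add, zFun_smul]
    exact hα₁.add (hα₂.const_smul _)
  -- ℓ8 compatibility, §1's Borel P2b′, then linearity of `toHN` read a.e.
  rw [iota_toHX_eq_toHN hb hφG hE hφZ, cnstN_toHN_eq_toHN_borelConstantTerm_of_measurable ν 𝓕 k a μZ h𝓕N hdis' hφm hφB' hφZ hψ2]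
  refine Lp.ext ((coeFn_toHN (↥(maximalRealSubfield L)) L (IsCMField.complexConj L) 3 k a μZ _ hψ2).trans ?_)
  refine EventuallyEq.trans ?_ ((Lp.coeFn_add _ _).trans ((coeFn_toHN (↥(maximalRealSubfield L)) L (IsCMField.complexConj L) 3 k a μZ _ hα₁).add (Lp.coeFn_smul _ _))).symm
  filter_upwards [coeFn_toHN (↥(maximalRealSubfield L)) L (IsCMField.complexConj L) 3 k a μZ _ hα₂] with x h₂
  rw [Pi.add_apply, Pi.smul_apply, h₂, hct', zFun_add, zFun_smul]
  rfl

end ConstantTerm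

/-! ## §3 (S3)χ `Q [Ẽ(f_z)] = 0`: the finiteness letter `hX` for a bounded section, the inner products, the projection -/

section CuspOrthogonal

variable (L : Type) [Field L] [NumberField L] [IsCMField L]
variable [MeasurableSpace (quasiSplit (↥(maximalRealSubfield L)) L (IsCMField.complexConj L) 3).Adelic] [BorelSpace (quasiSplit (↥(maximalRealSubfield L)) L (IsCMField.complexConj L) 3).Adelic]

omit [MeasurableSpace (quasiSplit (↥(maximalRealSubfield L)) L (IsCMField.complexConj L) 3).Adelic] [BorelSpace (quasiSplit (↥(maximalRealSubfield L)) L (IsCMField.complexConj L) 3).Adelic] in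
/-- **`Σ'_q ‖f_z(q·g)‖ₑ ≤ ofReal ‖φ‖_∞ · Σ'_q ‖H^z(q·g)‖ₑ`** for a bounded `φ` (termwise `‖φ H^z‖ ≤ M·‖1·H^z‖`, `ENNReal.tsum_le_tsum`, `ENNReal.tsum_mul_left`). [cite: MoeglinWaldspurger1995, II.1.5] -/
theorem tsum_enorm_flatSectionU_le_mul_tsum {ι : Type*} (q₀ : ι → (quasiSplit (↥(maximalRealSubfield L)) L (IsCMField.complexConj L) 3).Adelic)
    {φ : (quasiSplit (↥(maximalRealSubfield L)) L (IsCMField.complexConj L) 3).Adelic → ℂ} {M : ℝ} (hφM : ∀ x, ‖φ x‖ ≤ M) (z : ℂ) (g : (quasiSplit (↥(maximalRealSubfield L)) L (IsCMField.complexConj L) 3).Adelic) :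
    (∑' q, ‖flatSectionU φ z (q₀ q * g)‖ₑ) ≤ ENNReal.ofReal M * ∑' q, ‖flatSectionU (fun _ : (quasiSplit (↥(maximalRealSubfield L)) L (IsCMField.complexConj L) 3).Adelic => (1 : ℂ)) z (q₀ q * g)‖ₑ := by
  rw [← ENNReal.tsum_mul_left]
  refine ENNReal.tsum_le_tsum fun q => ?_
  rw [← ofReal_norm, ← ofReal_norm, ← ENNReal.ofReal_mul ((norm_nonneg _).trans (hφM 1)), norm_flatSectionU, norm_flatSectionU, norm_one, one_mul]
  exact ENNReal.ofReal_le_ofReal (mul_le_mul_of_nonneg_right (hφM _) (Real.rpow_nonneg (NNReal.coe_nonneg _) _))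

/-- **THE FINITENESS LETTER `hX` (ℓ10) FOR A BOUNDED SECTION**, `2 < Re z ≤ k`: `∫⁻_𝔛 (Σ_q ‖f_z(q x̃⁻¹)‖ₑ)·‖ψ̃ x‖ₑ dμ < ∞` for `ψ̃, w₁^{2k}ψ̃ ∈ L²(μ)` — the previous lemma and the ★ N = 3 spherical
discharge `lintegral_tsum_enorm_flatSectionU_mul_enorm_lt_top_cm_three` at `φ₀ = 1` (no `δ`-binders at N = 3). [cite: BernsteinLapid2019, §4 Claim 2 p. 9, §7] -/
theorem lintegral_tsum_enorm_flatSectionU_mul_enorm_lt_top_chi_cm_three (ν : Measure ↥(adelicUnipotent (↥(maximalRealSubfield L)) L (IsCMField.complexConj L) 3)) [ν.IsHaarMeasure]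
    {𝓕 : Set ↥(adelicUnipotent (↥(maximalRealSubfield L)) L (IsCMField.complexConj L) 3)}
    (h𝓕N : IsFundamentalDomain ↥(rationalUnipotent (↥(maximalRealSubfield L)) L (IsCMField.complexConj L) 3) 𝓕 ν) (h𝓕c : IsCompact (closure 𝓕))
    (μ : Measure (quasiSplit (↥(maximalRealSubfield L)) L (IsCMField.complexConj L) 3).automorphicQuotient) [IsFiniteMeasure μ]
    {φ : (quasiSplit (↥(maximalRealSubfield L)) L (IsCMField.complexConj L) 3).Adelic → ℂ} {M : ℝ} (hφM : ∀ x, ‖φ x‖ ≤ M) {z : ℂ} (hz : 2 < z.re) {k : ℕ} (hzk : z.re ≤ k)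
    {ψ : (quasiSplit (↥(maximalRealSubfield L)) L (IsCMField.complexConj L) 3).Adelic → ℂ} (hψ2 : MemLp ((quasiSplit (↥(maximalRealSubfield L)) L (IsCMField.complexConj L) 3).quotFun ψ) 2 μ)
    (hψw : MemLp (fun x => ((supHeight (↥(maximalRealSubfield L)) L (IsCMField.complexConj L) 3 x : ℝ) ^ (2 * k) : ℂ) * (quasiSplit (↥(maximalRealSubfield L)) L (IsCMField.complexConj L) 3).quotFun ψ x) 2 μ) :
    ∫⁻ x, (∑' q : Quotient (QuotientGroup.rightRel (arithmeticBorel (↥(maximalRealSubfield L)) L (IsCMField.complexConj L) 3)),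
        ‖(flatSectionU φ z) (((q.out : (quasiSplit (↥(maximalRealSubfield L)) L (IsCMField.complexConj L) 3).arithmeticSubgroup) : (quasiSplit (↥(maximalRealSubfield L)) L (IsCMField.complexConj L) 3).Adelic) *
          (Quotient.out x : (quasiSplit (↥(maximalRealSubfield L)) L (IsCMField.complexConj L) 3).Adelic)⁻¹)‖ₑ) *
        ‖(quasiSplit (↥(maximalRealSubfield L)) L (IsCMField.complexConj L) 3).quotFun ψ x‖ₑ ∂μ < ∞ := by
  have h1 := lintegral_tsum_enorm_flatSectionU_mul_enorm_lt_top_cm_three L ν h𝓕N h𝓕c μ (1 : ℂ) hz hzk hψ2 hψw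
  have hpt := fun x : (quasiSplit (↥(maximalRealSubfield L)) L (IsCMField.complexConj L) 3).automorphicQuotient =>
    tsum_enorm_flatSectionU_le_mul_tsum L
      (fun q : Quotient (QuotientGroup.rightRel (arithmeticBorel (↥(maximalRealSubfield L)) L (IsCMField.complexConj L) 3)) =>
        (((q.out : (quasiSplit (↥(maximalRealSubfield L)) L (IsCMField.complexConj L) 3).arithmeticSubgroup) : (quasiSplit (↥(maximalRealSubfield L)) L (IsCMField.complexConj L) 3).Adelic)))
      hφM z ((Quotient.out x : (quasiSplit (↥(maximalRealSubfield L)) L (IsCMField.complexConj L) 3).Adelic)⁻¹)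
  refine lt_of_le_of_lt (lintegral_mono fun x => mul_le_mul' (hpt x) le_rfl) ?_
  simp_rw [mul_assoc]
  rw [lintegral_const_mul' _ _ ENNReal.ofReal_ne_top]
  exact ENNReal.mul_lt_top ENNReal.ofReal_lt_top h1

/-- **⟪[w₁^{2k}ψ̃], [Ẽ(f_z)]⟫_{𝓗_k(𝔛)} = 0 FOR `ψ ∈ 𝒞_k` BOREL** (`2 < Re z ≤ k`, `φ` bounded Borel, left-`N(𝔸)B(F)`-invariant — INDEX-FREE; for a pair-section `hφN := IsChiSectionPair.unipotent_mul`, `hφB := .toAdelic_mul hφ hχ₂`): ★ «E ⊥ 𝒞_k» (generic in the section; `f_z` is Borel, left-`N(𝔸)`-invariant by `hφN`,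
left-`B(F)`-invariant by `hφB`) with its letter `hX` discharged above; the weighted inner product unfolds exactly as in the spherical file.
[cite: BernsteinLapid2019, §4 Claim 2 p. 9] [cite: MoeglinWaldspurger1995, II.1.7] -/
theorem inner_toHX_eisensteinSeriesU_eq_zero_chi_cm_three (μ : Measure (quasiSplit (↥(maximalRealSubfield L)) L (IsCMField.complexConj L) 3).automorphicQuotient) [(quasiSplit (↥(maximalRealSubfield L)) L (IsCMField.complexConj L) 3).IsAutomorphicMeasure μ]
    (νG : Measure (quasiSplit (↥(maximalRealSubfield L)) L (IsCMField.complexConj L) 3).Adelic) [νG.IsHaarMeasure] [νG.IsInvInvariant]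
    (ν : Measure ↥(adelicUnipotent (↥(maximalRealSubfield L)) L (IsCMField.complexConj L) 3)) [ν.IsHaarMeasure] [ν.IsInvInvariant]
    {𝓕 : Set ↥(adelicUnipotent (↥(maximalRealSubfield L)) L (IsCMField.complexConj L) 3)}
    (h𝓕N : IsFundamentalDomain ↥(rationalUnipotent (↥(maximalRealSubfield L)) L (IsCMField.complexConj L) 3) 𝓕 ν) (h𝓕c : IsCompact (closure 𝓕))
    {φ : (quasiSplit (↥(maximalRealSubfield L)) L (IsCMField.complexConj L) 3).Adelic → ℂ}
    (hφN : ∀ (u : ↥(adelicUnipotent (↥(maximalRealSubfield L)) L (IsCMField.complexConj L) 3)) (g : (quasiSplit (↥(maximalRealSubfield L)) L (IsCMField.complexConj L) 3).Adelic), φ ((u : (quasiSplit (↥(maximalRealSubfield L)) L (IsCMField.complexConj L) 3).Adelic) * g) = φ g)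
    (hφB : ∀ b ∈ borelU ((IsCMField.complexConj L : L ≃ₐ[↥(maximalRealSubfield L)] L) : L →+* L) ((StdForm.antidiagonal 3).over L),
      ∀ x : (quasiSplit (↥(maximalRealSubfield L)) L (IsCMField.complexConj L) 3).Adelic, φ ((quasiSplit (↥(maximalRealSubfield L)) L (IsCMField.complexConj L) 3).toAdelic b * x) = φ x)
    (hφm : Measurable φ) {M : ℝ} (hφM : ∀ x, ‖φ x‖ ≤ M)
    {z : ℂ} (hz : 2 < z.re) {k : ℕ} (hzk : z.re ≤ k)
    (hE : MemLp ((quasiSplit (↥(maximalRealSubfield L)) L (IsCMField.complexConj L) 3).quotFun (eisensteinSeriesU (flatSectionU φ z))) 2 (μ.withDensity fun x => (((supHeight (↥(maximalRealSubfield L)) L (IsCMField.complexConj L) 3 x)⁻¹ ^ (2 * k) : ℝ≥0) : ℝ≥0∞)))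
    {ψ : (quasiSplit (↥(maximalRealSubfield L)) L (IsCMField.complexConj L) 3).Adelic → ℂ} (hψ : ψ ∈ cuspTestClass (↥(maximalRealSubfield L)) L (IsCMField.complexConj L) 3 k ν 𝓕 μ) (hψm : Measurable ψ)
    (s : HX (↥(maximalRealSubfield L)) L (IsCMField.complexConj L) 3 k μ) (hs : (s : (quasiSplit (↥(maximalRealSubfield L)) L (IsCMField.complexConj L) 3).automorphicQuotient → ℂ) =ᵐ[μ.withDensity fun x => (((supHeight (↥(maximalRealSubfield L)) L (IsCMField.complexConj L) 3 x)⁻¹ ^ (2 * k) : ℝ≥0) : ℝ≥0∞)]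
      fun x => ((supHeight (↥(maximalRealSubfield L)) L (IsCMField.complexConj L) 3 x : ℝ) ^ (2 * k) : ℂ) * (quasiSplit (↥(maximalRealSubfield L)) L (IsCMField.complexConj L) 3).quotFun ψ x) :
    inner ℂ s (toHX (↥(maximalRealSubfield L)) L (IsCMField.complexConj L) 3 k μ (eisensteinSeriesU (flatSectionU φ z)) hE) = 0 := by
  haveI := t2Space_adeleRing_of_numberField L
  haveI := locallyCompactSpace_adeleRing' L
  haveI : T2Space (quasiSplit (↥(maximalRealSubfield L)) L (IsCMField.complexConj L) 3).Adelic := inferInstanceAs (T2Space (adelic (↥(maximalRealSubfield L)) L (IsCMField.complexConj L) 3 ((StdForm.antidiagonal 3).over L)))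
  have h𝓕₀ : ν 𝓕 ≠ 0 := measure_ne_zero_of_isFundamentalDomain_rationalUnipotent ν h𝓕N
  have h𝓕top : ν 𝓕 ≠ ∞ := ((measure_mono subset_closure).trans_lt h𝓕c.measure_lt_top).ne
  obtain ⟨c₀, hc₀, hwc⟩ := exists_pos_forall_le_supHeight_cm_three L
  -- the letters of ★ «E ⊥ 𝒞_k» for `f = f_z`
  have hfm : Measurable (flatSectionU φ z) := measurable_flatSectionU hφm z
  have hfN : ∀ (u : ↥(adelicUnipotent (↥(maximalRealSubfield L)) L (IsCMField.complexConj L) 3)) (g : (quasiSplit (↥(maximalRealSubfield L)) L (IsCMField.complexConj L) 3).Adelic),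
      (flatSectionU φ z) ((u : (quasiSplit (↥(maximalRealSubfield L)) L (IsCMField.complexConj L) 3).Adelic) * g) = (flatSectionU φ z) g := fun u g => by
    simp only [flatSectionU_apply, hφN u g, borelHeight_unipotent_mul u.2]
  have hfB : ∀ b ∈ arithmeticBorel (↥(maximalRealSubfield L)) L (IsCMField.complexConj L) 3, ∀ x : (quasiSplit (↥(maximalRealSubfield L)) L (IsCMField.complexConj L) 3).Adelic,
      (flatSectionU φ z) ((b : (quasiSplit (↥(maximalRealSubfield L)) L (IsCMField.complexConj L) 3).Adelic) * x) = (flatSectionU φ z) x :=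
    forall_arithmeticBorel_iff.2 (flatSectionU_toAdelic_mul hφB z)
  have hX := lintegral_tsum_enorm_flatSectionU_mul_enorm_lt_top_chi_cm_three L ν h𝓕N h𝓕c μ hφM hz hzk hψ.2.2.1 hψ.2.2.2
  have h0 := integral_quotFun_eisensteinSeriesU_mul_conj_eq_zero_of_mem_cuspTestClass_cm_three L μ νG ν h𝓕N h𝓕₀ h𝓕top hfm hfN hfB hψ hψm hX
  -- the weighted inner product, unfolded to `μ`
  have hEco : ((toHX (↥(maximalRealSubfield L)) L (IsCMField.complexConj L) 3 k μ (eisensteinSeriesU (flatSectionU φ z)) hE : HX (↥(maximalRealSubfield L)) L (IsCMField.complexConj L) 3 k μ) : (quasiSplit (↥(maximalRealSubfield L)) L (IsCMField.complexConj L) 3).automorphicQuotient → ℂ)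
      =ᵐ[μ.withDensity fun x => (((supHeight (↥(maximalRealSubfield L)) L (IsCMField.complexConj L) 3 x)⁻¹ ^ (2 * k) : ℝ≥0) : ℝ≥0∞)] (quasiSplit (↥(maximalRealSubfield L)) L (IsCMField.complexConj L) 3).quotFun (eisensteinSeriesU (flatSectionU φ z)) := by
    unfold toHX; exact hE.coeFn_toLp
  have hdm : Measurable fun x : (quasiSplit (↥(maximalRealSubfield L)) L (IsCMField.complexConj L) 3).automorphicQuotient => (supHeight (↥(maximalRealSubfield L)) L (IsCMField.complexConj L) 3 x)⁻¹ ^ (2 * k) := (measurable_supHeight.inv).pow_const _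
  rw [L2.inner_def, integral_congr_ae (hs.mp (hEco.mono fun x h1 h2 => by rw [h1, h2])), integral_withDensity_eq_integral_smul hdm]
  rw [← h0]
  refine integral_congr_ae (Eventually.of_forall fun x => ?_)
  have hw0 : ((supHeight (↥(maximalRealSubfield L)) L (IsCMField.complexConj L) 3 x : ℝ) : ℂ) ≠ 0 := by
    have : (0 : ℝ) < (supHeight (↥(maximalRealSubfield L)) L (IsCMField.complexConj L) 3 x : ℝ) := lt_of_lt_of_le (by exact_mod_cast hc₀) (by exact_mod_cast hwc x)
    exact_mod_cast this.ne'
  dsimp only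
  rw [RCLike.inner_apply, NNReal.smul_def, Complex.real_smul, map_mul, map_pow, Complex.conj_ofReal]
  push_cast
  have h1 : ((supHeight (↥(maximalRealSubfield L)) L (IsCMField.complexConj L) 3 x : ℝ) : ℂ)⁻¹ ^ (2 * k) * ((supHeight (↥(maximalRealSubfield L)) L (IsCMField.complexConj L) 3 x : ℝ) : ℂ) ^ (2 * k) = 1 := by
    rw [← mul_pow, inv_mul_cancel₀ hw0, one_pow]
  linear_combination (((quasiSplit (↥(maximalRealSubfield L)) L (IsCMField.complexConj L) 3).quotFun (eisensteinSeriesU (flatSectionU φ z)) x) *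
    (starRingEnd ℂ) ((quasiSplit (↥(maximalRealSubfield L)) L (IsCMField.complexConj L) 3).quotFun ψ x)) * h1

/-- **(S3)χ `Q [Ẽ(f_z)] = 0`.**  On `U(2,1)_{L∕L⁺}`, for a bounded Borel left-`N(𝔸)B(F)`-invariant `φ` (INDEX-FREE), `2 < Re z ≤ k`, and ANY set `𝒮 ⊆ 𝓗_k(𝔛)` of classes a.e. equal to `w₁^{2k}·ψ̃` with `ψ ∈ 𝒞_k` Borel, the
orthogonal projection onto the closed span of `𝒮` kills `[Ẽ(f_z)]` (★ spherical §3 `starProjection_topologicalClosure_span_eq_zero`). [cite: BernsteinLapid2019, §4 Claim 2 p. 9, §7] -/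
theorem starProjection_toHX_eisensteinSeriesU_eq_zero_chi_cm_three (μ : Measure (quasiSplit (↥(maximalRealSubfield L)) L (IsCMField.complexConj L) 3).automorphicQuotient) [(quasiSplit (↥(maximalRealSubfield L)) L (IsCMField.complexConj L) 3).IsAutomorphicMeasure μ]
    (νG : Measure (quasiSplit (↥(maximalRealSubfield L)) L (IsCMField.complexConj L) 3).Adelic) [νG.IsHaarMeasure] [νG.IsInvInvariant]
    (ν : Measure ↥(adelicUnipotent (↥(maximalRealSubfield L)) L (IsCMField.complexConj L) 3)) [ν.IsHaarMeasure] [ν.IsInvInvariant]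
    {𝓕 : Set ↥(adelicUnipotent (↥(maximalRealSubfield L)) L (IsCMField.complexConj L) 3)}
    (h𝓕N : IsFundamentalDomain ↥(rationalUnipotent (↥(maximalRealSubfield L)) L (IsCMField.complexConj L) 3) 𝓕 ν) (h𝓕c : IsCompact (closure 𝓕))
    {φ : (quasiSplit (↥(maximalRealSubfield L)) L (IsCMField.complexConj L) 3).Adelic → ℂ}
    (hφN : ∀ (u : ↥(adelicUnipotent (↥(maximalRealSubfield L)) L (IsCMField.complexConj L) 3)) (g : (quasiSplit (↥(maximalRealSubfield L)) L (IsCMField.complexConj L) 3).Adelic), φ ((u : (quasiSplit (↥(maximalRealSubfield L)) L (IsCMField.complexConj L) 3).Adelic) * g) = φ g)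
    (hφB : ∀ b ∈ borelU ((IsCMField.complexConj L : L ≃ₐ[↥(maximalRealSubfield L)] L) : L →+* L) ((StdForm.antidiagonal 3).over L),
      ∀ x : (quasiSplit (↥(maximalRealSubfield L)) L (IsCMField.complexConj L) 3).Adelic, φ ((quasiSplit (↥(maximalRealSubfield L)) L (IsCMField.complexConj L) 3).toAdelic b * x) = φ x)
    (hφm : Measurable φ) {M : ℝ} (hφM : ∀ x, ‖φ x‖ ≤ M)
    {z : ℂ} (hz : 2 < z.re) {k : ℕ} (hzk : z.re ≤ k)
    (hE : MemLp ((quasiSplit (↥(maximalRealSubfield L)) L (IsCMField.complexConj L) 3).quotFun (eisensteinSeriesU (flatSectionU φ z))) 2 (μ.withDensity fun x => (((supHeight (↥(maximalRealSubfield L)) L (IsCMField.complexConj L) 3 x)⁻¹ ^ (2 * k) : ℝ≥0) : ℝ≥0∞)))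
    {𝒮 : Set (HX (↥(maximalRealSubfield L)) L (IsCMField.complexConj L) 3 k μ)}
    (h𝒮 : ∀ s ∈ 𝒮, ∃ ψ ∈ cuspTestClass (↥(maximalRealSubfield L)) L (IsCMField.complexConj L) 3 k ν 𝓕 μ, Measurable ψ ∧
      (s : (quasiSplit (↥(maximalRealSubfield L)) L (IsCMField.complexConj L) 3).automorphicQuotient → ℂ) =ᵐ[μ.withDensity fun x => (((supHeight (↥(maximalRealSubfield L)) L (IsCMField.complexConj L) 3 x)⁻¹ ^ (2 * k) : ℝ≥0) : ℝ≥0∞)]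
        fun x => ((supHeight (↥(maximalRealSubfield L)) L (IsCMField.complexConj L) 3 x : ℝ) ^ (2 * k) : ℂ) * (quasiSplit (↥(maximalRealSubfield L)) L (IsCMField.complexConj L) 3).quotFun ψ x) :
    (Submodule.span ℂ 𝒮).topologicalClosure.starProjection (toHX (↥(maximalRealSubfield L)) L (IsCMField.complexConj L) 3 k μ (eisensteinSeriesU (flatSectionU φ z)) hE) = 0 := by
  refine starProjection_topologicalClosure_span_eq_zero fun s hs => ?_
  obtain ⟨ψ, hψ, hψm, hsψ⟩ := h𝒮 s hs
  exact inner_toHX_eisensteinSeriesU_eq_zero_chi_cm_three L μ νG ν h𝓕N h𝓕c hφN hφB hφm hφM hz hzk hE hψ hψm s hsψ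

end CuspOrthogonal

end Summit.HodgeConjecture.HodgeConjecture.Cruxes.H413.K2E1ChiEisensteinSolvesXSystemU3
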